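import Literature.NumberTheory.Automorphic.UnitaryThreeRamifiedTorusNormalForm     -- ★ the literal frame; brings ★ `exists_coe_eq_block_of_rel`, ★ `SplitDictionary.rel_of_coe_eq_block`, `LocalConjDatum`
import Literature.NumberTheory.Automorphic.TypeTwoMoebiusShiftValued             -- ★ the `(n, N) ↦ (n−2, N−1)` dictionary, denominators; brings ★ `MatrixMoebiusShift` (Möbius shift, shifted order)
import Literature.NumberTheory.Automorphic.ValuedFieldValuativeRelBridge         -- ★ `v_le_one_iff_mem_integer` (`Valued` ↔ `ValuativeRel` integers)
import HarnessLib

/-!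
# R90 · S6 — LINE G1 «geometric fixed subtree», RUNG 2 (B1): THE CAYLEY SHIFT OF A TYPE-(2) ELEMENT IN ITS LITERAL FRAME
# (`Theorems/R90S6TypeTwoCayleyBlock.lean`)

Cell `hodgecm-mathlib`, crux H413 (`stmt-HodgeConjecture-24833`), route of record `HCCMUnconditional`; programme R90-TF, section S6 (base `R90-C14`), seat R90-C14-p07 (g2,
heir of g0); S6 dealer R90-C14-plan (g2) RULING G1-R2 (2026-09-05T01:08:15Z) + re-deal 01:30:33Z, part (B) = (R2.c)+(R2.d) of the cut (heads v2
`R90/R90-C14-p07/g0/S6_G1_rung2_HEADS.v2.R90-C14-p07-g0.lean` bcae522735dd730a; REPAIR CENSUS f0b52447d8028ee0), FILE B1 of 2 (B2 = `R90S6TypeTwoCayleyShift`: the frame and the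
transport to an arbitrary type-(2) `γ`).  Helper lane `--supports stmt-HodgeConjecture-24833 --as helper`; THEOREMS ONLY (no definition, no instance, no notation, no named fact,
no `sorry`); imports = ★ `UnitaryThreeRamifiedTorusNormalForm` + ★ `TypeTwoMoebiusShiftValued` + ★ `ValuedFieldValuativeRelBridge` + HarnessLib.

THE MATHEMATICS [Kottwitz1986BaseChangeUnits, §1 pp. 240–241; Rogawski1990, §4.9 Prop. 4.9.1 (b) p. 55; Flicker1998UnitaryFL, §6].  `K` non-dyadic valued
(`hd : LocalConjDatum σ ϖ`), `U = U(σ, J₀)(K)`, `J₀ = antidiag(1,1,1)`.  A type-(2) element in its LITERAL FRAME is `t = (A 0 Cρ; 0 u 0; C 0 A) ∈ U` (★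
`exists_conj_coe_eq_ramifiedTorus`): `|ρ| = |ϖ|`, `σu·u = 1`, the `U(1,1)`-corner `M₂ = (A Cρ; C A)` unitary for `antidiag(1,1)` (★ `SplitDictionary.rel_of_coe_eq_block`), with
exponents `|C| = |ϖ|^N`, `|(u − A)² − C²ρ| = |ϖ|^n`, `2 ≤ n`, `1 ≤ N`.  (§1) block algebra of the `{e₀,e₂} ∕ {e₁}` pattern `(p 0 q; 0 e 0; r 0 s)` and the invariance of the shifted
order `𝒪[W]` under `W ↦ 1 + W`.  (§2) THE `2 × 2` CAYLEY BLOCK: `g₂ = u⁻¹M₂ = 1 + ϖX₂` with `X₂` integral, `|disc χ_{g₂}| = |ϖ|^{2N+1}`,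
`|χ_{g₂}(1)| = |ϖ|^n`; by ★ `skew_and_square_of_unitary_two`, ★ `valued_det_two_smul_one_add_shift_smul_eq_one` the cofactors `det(2 + (ϖ±1)X₂)` are units, so the MÖBIUS SHIFT
`Φ = φ(g₂) = N₊N₋⁻¹` (`N± = 2 + (ϖ±1)X₂`, ★ `moebius_one_add_smul_eq`) is unitary (★ `transpose_map_moebius_mul_mul`) and carries the exponents `(n−2, N−1)` (★
`valued_disc_moebius`, ★ `valued_eval_charpoly_moebius` at the shifted point `φ(1) = 1`).  (§3) THE LITERAL CAYLEY SHIFT: `Y = (Φ₀₀ 0 Φ₀₁; 0 1 0; Φ₁₀ 0 Φ₁₁) ∈ U` (★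
`exists_coe_eq_block_of_rel`) fixes every `u`-eigenvector of `t` (they are multiples of `e₁`, since `χ₂(u) ≠ 0`), has `(tr Y − 1)² − 4 det Y = disc χ_Φ`,
`1 − (tr Y − 1) + det Y = χ_Φ(1)`, and — with `W = ϖ⁻¹(u⁻¹t − 1)` integral, `Y = N₊(W)N₋(W)⁻¹` blockwise — `Y, Y⁻¹ ∈ 𝒪[1 + W]`, `1 + W ∈ 𝒪[Y]` (★ `moebius_mem_adjoin`, ★
`moebius_inv_mem_adjoin`, ★ `mem_adjoin_moebius`; `𝒪 = 𝒪[K]` of the `ValuativeRel`, bridged by ★ `v_le_one_iff_mem_integer`): the three memberships of ★ ROW 0 at `t`.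
HONEST LABEL: an assembly over the ★ Möbius-shift toolbox (road «S3-tree», brick T3′) in S6's abstract letters; count-neutral; consumed by FILE B2 and part (C).
HC_CM is proved only modulo the 7 printed citations (2 remaining named inputs: hLiu418 = stmt-HodgeConjecture-24832, h413 = stmt-HodgeConjecture-24833) until rung 0 closes.

## References
* [Kottwitz1986BaseChangeUnits] R. E. Kottwitz, *Base change for unit elements of Hecke algebras*, Compositio Math. 60 (1986) 237–250, §1 pp. 240–241.
* [Rogawski1990] J. D. Rogawski, *Automorphic Representations of Unitary Groups in Three Variables*, Ann. of Math. Stud. 123 (1990), §4.9 Prop. 4.9.1 (b) p. 55.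
* [Flicker1998UnitaryFL] Y. Z. Flicker, *Elementary proof of the fundamental lemma for a unitary group*, Canad. J. Math. 50 (1998), §6 (type-(2) exponents), Prop. 6 p. 83.
* [Weyl1939] H. Weyl, *The Classical Groups* (1939), Chap. II §10 (Cayley's rational parametrisation).
-/
set_option autoImplicit false
-- the mandated namespace repeats the single-problem summit's segment (`HodgeConjecture.HodgeConjecture`)
set_option linter.dupNamespace false

noncomputable section

open Matrix Polynomial
open Literature.NumberTheory.Automorphic Literature.NumberTheory.Automorphic.HermitianLattice Literature.NumberTheory.Automorphic.UnitaryGroup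
open Literature.NumberTheory.Automorphic.MoebiusShift
open scoped Matrix MatrixGroups WithZero ValuativeRel

namespace Summit.HodgeConjecture.HodgeConjecture.R90.S6

/-! ### §1 Block algebra of the `{e₀,e₂} ∕ {e₁}` pattern; `𝒪[1 + W] = 𝒪[W]` -/

section Pattern

variable {K : Type*} [Field K]

/-- Products of pattern matrices `(p 0 q; 0 e 0; r 0 s)` are computed blockwise (`H = U(1,1) × U(1)`). [cite: Rogawski1990, §4.8 Case (a) p. 53] -/
theorem cayleyPattern_mul (P Q : Matrix (Fin 2) (Fin 2) K) (p q : K) :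
    !![P 0 0, 0, P 0 1; 0, p, 0; P 1 0, 0, P 1 1] * !![Q 0 0, 0, Q 0 1; 0, q, 0; Q 1 0, 0, Q 1 1] =
      !![(P * Q) 0 0, 0, (P * Q) 0 1; 0, p * q, 0; (P * Q) 1 0, 0, (P * Q) 1 1] := by
  ext i j
  fin_cases i <;> fin_cases j <;> simp [Matrix.mul_apply, Fin.sum_univ_three, Fin.sum_univ_two]

/-- Linear combinations `x·1 + y·(pattern)` are pattern matrices, blockwise. [cite: Rogawski1990, §4.8 Case (a) p. 53] -/
theorem smul_one_add_smul_cayleyPattern (P : Matrix (Fin 2) (Fin 2) K) (p x y : K) :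
    x • (1 : Matrix (Fin 3) (Fin 3) K) + y • !![P 0 0, 0, P 0 1; 0, p, 0; P 1 0, 0, P 1 1] =
      !![(x • (1 : Matrix (Fin 2) (Fin 2) K) + y • P) 0 0, 0, (x • (1 : Matrix (Fin 2) (Fin 2) K) + y • P) 0 1; 0, x + y * p, 0;
        (x • (1 : Matrix (Fin 2) (Fin 2) K) + y • P) 1 0, 0, (x • (1 : Matrix (Fin 2) (Fin 2) K) + y • P) 1 1] := by
  ext i j
  fin_cases i <;> fin_cases j <;> simp

/-- The determinant of a pattern matrix is the product of the block determinants. [cite: Rogawski1990, §4.8 Case (a) p. 53] -/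
theorem det_cayleyPattern (P : Matrix (Fin 2) (Fin 2) K) (p : K) :
    (!![P 0 0, 0, P 0 1; 0, p, 0; P 1 0, 0, P 1 1] : Matrix (Fin 3) (Fin 3) K).det = p * P.det := by
  rw [Matrix.det_fin_three, Matrix.det_fin_two]
  simp
  ring

/-- The trace of a pattern matrix is the sum of the block traces. [cite: Rogawski1990, §4.8 Case (a) p. 53] -/
theorem trace_cayleyPattern (P : Matrix (Fin 2) (Fin 2) K) (p : K) :
    (!![P 0 0, 0, P 0 1; 0, p, 0; P 1 0, 0, P 1 1] : Matrix (Fin 3) (Fin 3) K).trace = P.trace + p := by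
  rw [Matrix.trace_fin_three, Matrix.trace_fin_two]
  simp
  ring

/-- The entries of the `σ`-Gram product `ᵗ(σP)·antidiag(1,1)·Q` of two `2 × 2` matrices. [cite: Rogawski1990, §1.9 p. 8] -/
theorem transpose_map_mul_antidiag_mul_apply (σ : K →+* K) (P Q : Matrix (Fin 2) (Fin 2) K) (i j : Fin 2) :
    ((P.map σ)ᵀ * !![(0 : K), 1; 1, 0] * Q) i j = σ (P 0 i) * Q 1 j + σ (P 1 i) * Q 0 j := by
  fin_cases i <;> fin_cases j <;> simp [Matrix.mul_apply, Fin.sum_univ_two] <;> ring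

variable (O : Subring K)

/-- The shifted order does not see the shift by `1`: `𝒪[1 + W] = 𝒪[W]`. [cite: Kottwitz1986BaseChangeUnits, §1 pp. 240–241] -/
theorem adjoin_one_add_eq {m : Type*} [Fintype m] [DecidableEq m] (W : Matrix m m K) :
    Algebra.adjoin O ({1 + W} : Set (Matrix m m K)) = Algebra.adjoin O ({W} : Set (Matrix m m K)) := by
  apply le_antisymm
  · refine Algebra.adjoin_le (Set.singleton_subset_iff.2 ?_)
    exact Subalgebra.add_mem _ (Subalgebra.one_mem _) (Algebra.self_mem_adjoin_singleton O W)
  · refine Algebra.adjoin_le (Set.singleton_subset_iff.2 ?_)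
    have h : (1 + W) - 1 ∈ Algebra.adjoin O ({1 + W} : Set (Matrix m m K)) :=
      Subalgebra.sub_mem _ (Algebra.self_mem_adjoin_singleton O (1 + W)) (Subalgebra.one_mem _)
    rwa [add_sub_cancel_left] at h

end Pattern

/-! ### §2 The `2 × 2` Cayley block of the literal frame -/

section Block

variable {K : Type*} [Field K] [Valued K ℤᵐ⁰] {σ : K →+* K} {ϖ : K}

/-- Square root in `ℤᵐ⁰`: `|ϖ|·c² = |ϖ^{2N+1}|` forces `c = |ϖ^N|` (`c ≠ 0`). [cite: Flicker1998UnitaryFL, Theorem 18 p. 97] -/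
theorem v_eq_of_mul_sq_eq (hϖ : Valued.v ϖ = WithZero.exp (-1 : ℤ)) {c : ℤᵐ⁰} (hc : c ≠ 0) {N : ℕ}
    (h : Valued.v ϖ * c ^ 2 = Valued.v (ϖ ^ (2 * N + 1))) : c = Valued.v (ϖ ^ N) := by
  rw [map_pow, hϖ, ← WithZero.exp_nsmul, ← WithZero.exp_log hc, ← WithZero.exp_nsmul, ← WithZero.exp_add, WithZero.exp_inj, nsmul_eq_mul, nsmul_eq_mul] at h
  rw [← WithZero.exp_log hc, map_pow, hϖ, ← WithZero.exp_nsmul, nsmul_eq_mul]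
  congr 1
  push_cast at h ⊢
  omega

/-- `|a|² ≤ |ϖ|²` forces `|a| ≤ |ϖ|` in `ℤᵐ⁰`. [cite: Flicker1998UnitaryFL, Theorem 18 p. 97] -/
theorem v_le_of_sq_le_sq (hϖ : Valued.v ϖ = WithZero.exp (-1 : ℤ)) {a : K} (h : Valued.v a ^ 2 ≤ Valued.v ϖ ^ 2) : Valued.v a ≤ Valued.v ϖ := by
  by_cases ha : Valued.v a = 0
  · rw [ha]; exact zero_le
  · rw [← WithZero.exp_log ha, hϖ, ← WithZero.exp_nsmul, ← WithZero.exp_nsmul, WithZero.exp_le_exp] at h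
    rw [← WithZero.exp_log ha, hϖ, WithZero.exp_le_exp]
    simp only [nsmul_eq_mul, Nat.cast_ofNat] at h
    omega

/-- **THE `2 × 2` CAYLEY BLOCK.**  For the corner `M₂ = (A Cρ; C A)` of a literal type-(2) element (relations (R1)–(R4) of `U(σ, antidiag(1,1))`, `σu·u = 1`,
`|ρ| = |ϖ|`, `|C| = |ϖ^N|`, `|(u − A)² − C²ρ| = |ϖ^n|`, `2 ≤ n`, `1 ≤ N`): `X₂ = ϖ⁻¹(u⁻¹M₂ − 1)` is integral, the cofactors `det(2 + (ϖ∓1)X₂)` are units, and the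
Möbius shift `Φ = (2 + (ϖ+1)X₂)(2 + (ϖ−1)X₂)⁻¹` satisfies the four `antidiag(1,1)`-relations, `|tr Φ² − 4 det Φ| = |ϖ^{2(N−1)+1}|` and `|χ_Φ(1)| = |ϖ^{n−2}|`.
[cite: Kottwitz1986BaseChangeUnits, §1 pp. 240–241] [cite: Flicker1998UnitaryFL, §6] [cite: Weyl1939, Chap. II §10] -/
theorem cayleyBlock_two (hd : LocalConjDatum σ ϖ) {A C ρ u : K}
    (R1 : σ A * C + σ C * A = 0) (R2 : σ A * A + σ C * (C * ρ) = 1) (R3 : σ (C * ρ) * C + σ A * A = 1) (R4 : σ (C * ρ) * A + σ A * (C * ρ) = 0)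
    (hσu : σ u * u = 1) (hvρ : Valued.v ρ = Valued.v ϖ) {N n : ℕ} (hvC : Valued.v C = Valued.v (ϖ ^ N))
    (hχ : Valued.v ((u - A) ^ 2 - C ^ 2 * ρ) = Valued.v (ϖ ^ n)) (hn2 : 2 ≤ n) (hN1 : 1 ≤ N)
    (X₂ : Matrix (Fin 2) (Fin 2) K) (hX₂ : X₂ = ϖ⁻¹ • (u⁻¹ • !![A, C * ρ; C, A] - 1))
    (Φ : Matrix (Fin 2) (Fin 2) K) (hΦ : Φ = ((2 : K) • (1 : Matrix (Fin 2) (Fin 2) K) + (ϖ + 1) • X₂) * ((2 : K) • (1 : Matrix (Fin 2) (Fin 2) K) + (ϖ - 1) • X₂)⁻¹) :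
    (∀ i j, Valued.v (X₂ i j) ≤ 1) ∧
      Valued.v (((2 : K) • (1 : Matrix (Fin 2) (Fin 2) K) + (ϖ - 1) • X₂).det) = 1 ∧ Valued.v (((2 : K) • (1 : Matrix (Fin 2) (Fin 2) K) + (ϖ + 1) • X₂).det) = 1 ∧
      (σ (Φ 0 0) * Φ 1 0 + σ (Φ 1 0) * Φ 0 0 = 0 ∧ σ (Φ 0 0) * Φ 1 1 + σ (Φ 1 0) * Φ 0 1 = 1 ∧
        σ (Φ 0 1) * Φ 1 0 + σ (Φ 1 1) * Φ 0 0 = 1 ∧ σ (Φ 0 1) * Φ 1 1 + σ (Φ 1 1) * Φ 0 1 = 0) ∧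
      Valued.v (Φ.trace ^ 2 - 4 * Φ.det) = Valued.v (ϖ ^ (2 * (N - 1) + 1)) ∧
      Valued.v (Φ.charpoly.eval 1) = Valued.v (ϖ ^ (n - 2)) := by
  have hϖ0 : ϖ ≠ 0 := hd.ϖ_ne_zero
  have hvϖ := hd.vϖ
  have hvpow : ∀ j : ℕ, Valued.v (ϖ ^ j) = WithZero.exp (-(j : ℤ)) := fun j => by
    rw [map_pow, hvϖ, ← WithZero.exp_nsmul, nsmul_eq_mul, mul_neg, mul_one]
  obtain ⟨-, hvϖ1, hvm1, hvp1, -, -⟩ := shift_parameter_facts hvϖ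
  have h20 : (2 : K) ≠ 0 := fun h0 => by have := hd.v2; rw [h0, map_zero] at this; exact zero_ne_one this
  have hv4 : Valued.v (4 : K) = 1 := by rw [show (4 : K) = 2 * 2 by norm_num, map_mul, hd.v2, one_mul]
  have hvu : Valued.v u = 1 := by
    -- `|u|² = 1` in `ℤᵐ⁰` (norm-one scalar, `σ` isometric)
    have h := congrArg Valued.v hσu
    rw [map_mul, hd.vσ, map_one] at h
    have hu0 : Valued.v u ≠ 0 := fun h0 => by rw [h0, mul_zero] at h; exact zero_ne_one h
    rw [← WithZero.exp_log hu0, ← WithZero.exp_add, ← WithZero.exp_zero, WithZero.exp_inj] at h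
    rw [← WithZero.exp_log hu0, ← WithZero.exp_zero]
    congr 1; omega
  have hu0 : u ≠ 0 := fun h => by rw [h, map_zero] at hvu; exact zero_ne_one hvu
  have hvu' : Valued.v u⁻¹ = 1 := by rw [map_inv₀, hvu, inv_one]
  have hσu' : (σ u)⁻¹ * u⁻¹ = 1 := by rw [← mul_inv, hσu, inv_one]
  have R3' : σ C * σ ρ * C + σ A * A = 1 := by rw [← map_mul]; exact R3
  have R4' : σ C * σ ρ * A + σ A * (C * ρ) = 0 := by rw [← map_mul]; exact R4
  set M₂ : Matrix (Fin 2) (Fin 2) K := !![A, C * ρ; C, A] with hM₂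
  -- `1 + ϖX₂ = u⁻¹M₂`
  have hg₂ : (1 : Matrix (Fin 2) (Fin 2) K) + ϖ • X₂ = u⁻¹ • M₂ := by rw [hX₂]; exact (eq_one_add_smul_inv_smul_sub_one hϖ0 _).symm
  -- exponent bounds: `|A − u| ≤ |ϖ|`, `|C| ≤ |ϖ|`, `|Cρ| ≤ |ϖ|`
  have hCρ : Valued.v (C ^ 2 * ρ) = Valued.v (ϖ ^ (2 * N + 1)) := by
    rw [map_mul, map_pow, hvC, hvρ, hvpow, hvϖ, hvpow, ← WithZero.exp_nsmul, ← WithZero.exp_add]; congr 1; push_cast; ring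
  have hAu : Valued.v (u - A) ≤ Valued.v ϖ := by
    refine v_le_of_sq_le_sq hvϖ ?_
    have h1 : Valued.v ((u - A) ^ 2) ≤ max (Valued.v ((u - A) ^ 2 - C ^ 2 * ρ)) (Valued.v (C ^ 2 * ρ)) := by
      have e : (u - A) ^ 2 = ((u - A) ^ 2 - C ^ 2 * ρ) + C ^ 2 * ρ := by ring
      rw [e]; exact Valuation.map_add _ _ _ |>.trans (by rw [← e])
    rw [map_pow] at h1
    refine h1.trans (max_le ?_ ?_)
    · rw [hχ, hvpow, hvϖ, ← WithZero.exp_nsmul, WithZero.exp_le_exp]; simp only [nsmul_eq_mul]; push_cast; omega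
    · rw [hCρ, hvpow, hvϖ, ← WithZero.exp_nsmul, WithZero.exp_le_exp]; simp only [nsmul_eq_mul]; push_cast; omega
  have hCle : Valued.v C ≤ Valued.v ϖ := by rw [hvC, hvpow, hvϖ, WithZero.exp_le_exp]; omega
  have hCρle : Valued.v (C * ρ) ≤ Valued.v ϖ := by
    rw [map_mul, hvρ]
    calc Valued.v C * Valued.v ϖ ≤ 1 * Valued.v ϖ := mul_le_mul' (hCle.trans hvϖ1.le) le_rfl
      _ = Valued.v ϖ := one_mul _
  -- integrality of `X₂`
  have hX₂int : ∀ i j, Valued.v (X₂ i j) ≤ 1 := by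
    rw [hX₂]
    refine forall_valued_inv_smul_sub_one_le_one hϖ0 fun i j => ?_
    fin_cases i <;> fin_cases j
    · show Valued.v ((u⁻¹ • M₂ - 1) 0 0) ≤ _
      have e : (u⁻¹ • M₂ - 1) 0 0 = -(u⁻¹ * (u - A)) := by simp [hM₂]; field_simp; ring
      rw [e, Valuation.map_neg, map_mul, hvu', one_mul]; exact hAu
    · show Valued.v ((u⁻¹ • M₂ - 1) 0 1) ≤ _
      have e : (u⁻¹ • M₂ - 1) 0 1 = u⁻¹ * (C * ρ) := by simp [hM₂]
      rw [e, map_mul, hvu', one_mul]; exact hCρle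
    · show Valued.v ((u⁻¹ • M₂ - 1) 1 0) ≤ _
      have e : (u⁻¹ • M₂ - 1) 1 0 = u⁻¹ * C := by simp [hM₂]
      rw [e, map_mul, hvu', one_mul]; exact hCle
    · show Valued.v ((u⁻¹ • M₂ - 1) 1 1) ≤ _
      have e : (u⁻¹ • M₂ - 1) 1 1 = -(u⁻¹ * (u - A)) := by simp [hM₂]; field_simp; ring
      rw [e, Valuation.map_neg, map_mul, hvu', one_mul]; exact hAu
  -- unitarity of `g₂ = 1 + ϖX₂` for `antidiag(1,1)`
  have hg : ((((1 : Matrix (Fin 2) (Fin 2) K) + ϖ • X₂).map σ)ᵀ * !![(0 : K), 1; 1, 0] * ((1 : Matrix (Fin 2) (Fin 2) K) + ϖ • X₂)) = !![(0 : K), 1; 1, 0] := by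
    rw [hg₂]
    ext i j
    rw [transpose_map_mul_antidiag_mul_apply]
    fin_cases i <;> fin_cases j
    · simp [hM₂]; linear_combination ((σ u)⁻¹ * u⁻¹) * R1
    · simp [hM₂]; linear_combination ((σ u)⁻¹ * u⁻¹) * R2 + hσu'
    · simp [hM₂]; linear_combination ((σ u)⁻¹ * u⁻¹) * R3' + hσu'
    · simp [hM₂]; linear_combination ((σ u)⁻¹ * u⁻¹) * R4'
  -- the exponents of `g₂`: `|disc| = exp(−(2N+1))`, `|χ(1)| = exp(−n)`
  have htr : (u⁻¹ • M₂).trace = u⁻¹ * (2 * A) := by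
    simp only [Matrix.trace_fin_two, Matrix.smul_apply, smul_eq_mul, hM₂, of_apply, cons_val', cons_val_zero, cons_val_one, empty_val', cons_val_fin_one]; ring
  have hdet : (u⁻¹ • M₂).det = u⁻¹ ^ 2 * (A ^ 2 - C ^ 2 * ρ) := by
    simp only [Matrix.det_fin_two, Matrix.smul_apply, smul_eq_mul, hM₂, of_apply, cons_val', cons_val_zero, cons_val_one, empty_val', cons_val_fin_one]; ring
  have hN₂ : Valued.v (((1 : Matrix (Fin 2) (Fin 2) K) + ϖ • X₂).trace ^ 2 - 4 * ((1 : Matrix (Fin 2) (Fin 2) K) + ϖ • X₂).det) = WithZero.exp (-((2 * N + 1 : ℕ) : ℤ)) := by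
    rw [hg₂, htr, hdet, show (u⁻¹ * (2 * A)) ^ 2 - 4 * (u⁻¹ ^ 2 * (A ^ 2 - C ^ 2 * ρ)) = u⁻¹ ^ 2 * (4 * (C ^ 2 * ρ)) by ring, map_mul, map_pow, hvu', one_pow, one_mul,
      map_mul, hv4, one_mul, hCρ, hvpow]
  have hn₂ : Valued.v (((1 : Matrix (Fin 2) (Fin 2) K) + ϖ • X₂).charpoly.eval 1) = WithZero.exp (-(n : ℤ)) := by
    rw [hg₂, Matrix.charpoly_fin_two, htr, hdet]
    simp only [eval_add, eval_sub, eval_mul, eval_pow, eval_C, eval_X]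
    rw [show (1 : K) ^ 2 - u⁻¹ * (2 * A) * 1 + u⁻¹ ^ 2 * (A ^ 2 - C ^ 2 * ρ) = u⁻¹ ^ 2 * ((u - A) ^ 2 - C ^ 2 * ρ) by field_simp; ring, map_mul, map_pow, hvu',
      one_pow, one_mul, hχ, hvpow]
  -- ★ the dictionary
  obtain ⟨hskew, hsq⟩ := skew_and_square_of_unitary_two σ hd.vσ hvϖ hd.σϖ hX₂int hg hN1 hN₂
  obtain ⟨hm, hp⟩ := valued_det_two_smul_one_add_shift_smul_eq_one σ hd.vσ hd.v2 hvϖ hX₂int hskew hsq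
  obtain ⟨hDm, -⟩ := valued_det_shift_denominators hvϖ (X := X₂) hm hp
  have hdisc := valued_disc_moebius hd.v2 hvϖ ((1 : Matrix (Fin 2) (Fin 2) K) + ϖ • X₂) hDm hN1 hN₂
  have hu1 : Valued.v ((ϖ - 1) * 1 + (ϖ + 1)) = WithZero.exp (-1 : ℤ) := by
    rw [show (ϖ - 1) * 1 + (ϖ + 1) = 2 * ϖ by ring, map_mul, hd.v2, one_mul, hvϖ]
  have heval := valued_eval_charpoly_moebius hd.v2 hvϖ ((1 : Matrix (Fin 2) (Fin 2) K) + ϖ • X₂) 1 hDm hu1 hn2 hn₂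
  have hφ1 : ((ϖ + 1) * 1 + (ϖ - 1)) / ((ϖ - 1) * 1 + (ϖ + 1)) = 1 := by
    rw [show (ϖ + 1) * 1 + (ϖ - 1) = (ϖ - 1) * 1 + (ϖ + 1) by ring]
    exact div_self (by rw [show (ϖ - 1) * 1 + (ϖ + 1) = 2 * ϖ by ring]; exact mul_ne_zero h20 hϖ0)
  rw [hφ1] at heval
  -- `φ(1 + ϖX₂) = Φ`
  have hmU : IsUnit (((2 : K) • (1 : Matrix (Fin 2) (Fin 2) K) + (ϖ - 1) • X₂).det) :=
    isUnit_iff_ne_zero.2 fun h0 => by rw [h0, map_zero] at hm; exact zero_ne_one hm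
  have hmoeb : ((ϖ + 1) • ((1 : Matrix (Fin 2) (Fin 2) K) + ϖ • X₂) + (ϖ - 1) • (1 : Matrix (Fin 2) (Fin 2) K)) *
      ((ϖ - 1) • ((1 : Matrix (Fin 2) (Fin 2) K) + ϖ • X₂) + (ϖ + 1) • (1 : Matrix (Fin 2) (Fin 2) K))⁻¹ = Φ := by
    rw [hΦ]; exact moebius_one_add_smul_eq X₂ hϖ0 hmU
  rw [hmoeb] at hdisc heval
  -- unitarity of `Φ` (★ the Möbius shift preserves the form)
  have hDU : IsUnit ((ϖ - 1) • ((1 : Matrix (Fin 2) (Fin 2) K) + ϖ • X₂) + (ϖ + 1) • (1 : Matrix (Fin 2) (Fin 2) K)).det :=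
    isUnit_iff_ne_zero.2 fun h0 => by rw [h0, map_zero] at hDm; exact WithZero.zero_ne_coe hDm
  have hσp : σ (ϖ + 1) = ϖ + 1 := by rw [map_add, hd.σϖ, map_one]
  have hσm : σ (ϖ - 1) = ϖ - 1 := by rw [map_sub, hd.σϖ, map_one]
  have hU := transpose_map_moebius_mul_mul σ !![(0 : K), 1; 1, 0] ((1 : Matrix (Fin 2) (Fin 2) K) + ϖ • X₂) hg hσp hσm hDU
  rw [hmoeb] at hU
  have h00 := congrFun (congrFun hU 0) 0
  have h01 := congrFun (congrFun hU 0) 1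
  have h10 := congrFun (congrFun hU 1) 0
  have h11 := congrFun (congrFun hU 1) 1
  rw [transpose_map_mul_antidiag_mul_apply] at h00 h01 h10 h11
  simp only [Fin.isValue, of_apply, cons_val', cons_val_zero, cons_val_one, empty_val', cons_val_fin_one] at h00 h01 h10 h11
  refine ⟨hX₂int, hm, hp, ⟨h00, h01, h10, h11⟩, ?_, ?_⟩
  · rw [hdisc, hvpow]
  · rw [heval, hvpow]

end Block

/-! ### §3 The Cayley shift of a type-(2) element in its literal frame -/

section Literal

variable {K : Type*} [Field K] [Valued K ℤᵐ⁰] [ValuativeRel K] [(Valued.v : Valuation K ℤᵐ⁰).Compatible] {σ : K →+* K} {ϖ : K}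

set_option maxHeartbeats 800000 in
-- nine-entry pattern computations and three ★ order lemmas on `3 × 3` matrices in one proof
/-- **G1 RUNG 2 (B1) — THE CAYLEY SHIFT IN THE LITERAL FRAME.**  Let `t = (A 0 Cρ; 0 u 0; C 0 A) ∈ U(σ, J₀)(K)` (`K` non-dyadic, `hd : LocalConjDatum σ ϖ`) with
`|ρ| = |ϖ|`, `|C| = |ϖ^N|`, `|(u − A)² − C²ρ| = |ϖ^n|`, `2 ≤ n`, `1 ≤ N`, and let `x` be any `u`-eigenvector of `t`.  Then there is `Y ∈ U` — the Möbius shift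
`φ_ϖ(u⁻¹t) = (Φ₀₀ 0 Φ₀₁; 0 1 0; Φ₁₀ 0 Φ₁₁)`, `Φ = φ_ϖ(u⁻¹(A Cρ; C A))` — with `Y x = x`, `|(tr Y − 1)² − 4 det Y| = |ϖ^{2(N−1)+1}|`, `|1 − (tr Y − 1) + det Y| = |ϖ^{n−2}|`,
and the three shifted-order memberships of ★ ROW 0: `Y, Y⁻¹ ∈ 𝒪[X]`, `X ∈ 𝒪[Y]` for `X = 1 + ϖ⁻¹(u⁻¹t − 1)` (`𝒪 = 𝒪[K]` of the valuative relation).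
[cite: Kottwitz1986BaseChangeUnits, §1 pp. 240–241] [cite: Rogawski1990, §4.9 Prop. 4.9.1 (b) p. 55] [cite: Flicker1998UnitaryFL, §6] -/
theorem exists_cayleyShift_literal (hd : LocalConjDatum σ ϖ)
    {t : ↥(unitaryGroupOfForm σ ((StdForm.antidiagonal 3).over K))} {A C ρ u : K}
    (ht : ((t : GL (Fin 3) K) : Matrix (Fin 3) (Fin 3) K) = !![A, 0, C * ρ; 0, u, 0; C, 0, A])
    (hvρ : Valued.v ρ = Valued.v ϖ) {N n : ℕ} (hvC : Valued.v C = Valued.v (ϖ ^ N)) (hχ : Valued.v ((u - A) ^ 2 - C ^ 2 * ρ) = Valued.v (ϖ ^ n))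
    (hn2 : 2 ≤ n) (hN1 : 1 ≤ N) {x : Fin 3 → K} (htx : ((t : GL (Fin 3) K) : Matrix (Fin 3) (Fin 3) K) *ᵥ x = u • x) :
    ∃ Y : ↥(unitaryGroupOfForm σ ((StdForm.antidiagonal 3).over K)),
      ((Y : GL (Fin 3) K) : Matrix (Fin 3) (Fin 3) K) *ᵥ x = (1 : K) • x ∧
      Valued.v ((Matrix.trace ((Y : GL (Fin 3) K) : Matrix (Fin 3) (Fin 3) K) - 1) ^ 2 - 4 * (Matrix.det ((Y : GL (Fin 3) K) : Matrix (Fin 3) (Fin 3) K) / 1)) =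
        Valued.v (ϖ ^ (2 * (N - 1) + 1)) ∧
      Valued.v ((1 : K) ^ 2 - (Matrix.trace ((Y : GL (Fin 3) K) : Matrix (Fin 3) (Fin 3) K) - 1) * 1 + Matrix.det ((Y : GL (Fin 3) K) : Matrix (Fin 3) (Fin 3) K) / 1) =
        Valued.v (ϖ ^ (n - 2)) ∧
      ((Y : GL (Fin 3) K) : Matrix (Fin 3) (Fin 3) K) ∈ Algebra.adjoin 𝒪[K]
        ({1 + ϖ⁻¹ • (u⁻¹ • ((t : GL (Fin 3) K) : Matrix (Fin 3) (Fin 3) K) - 1)} : Set (Matrix (Fin 3) (Fin 3) K)) ∧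
      ((((Y : GL (Fin 3) K))⁻¹ : GL (Fin 3) K) : Matrix (Fin 3) (Fin 3) K) ∈ Algebra.adjoin 𝒪[K]
        ({1 + ϖ⁻¹ • (u⁻¹ • ((t : GL (Fin 3) K) : Matrix (Fin 3) (Fin 3) K) - 1)} : Set (Matrix (Fin 3) (Fin 3) K)) ∧
      (1 + ϖ⁻¹ • (u⁻¹ • ((t : GL (Fin 3) K) : Matrix (Fin 3) (Fin 3) K) - 1)) ∈ Algebra.adjoin 𝒪[K]
        ({((Y : GL (Fin 3) K) : Matrix (Fin 3) (Fin 3) K)} : Set (Matrix (Fin 3) (Fin 3) K)) := by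
  have hϖ0 : ϖ ≠ 0 := hd.ϖ_ne_zero
  have hvϖ := hd.vϖ
  have hvpow : ∀ j : ℕ, Valued.v (ϖ ^ j) = WithZero.exp (-(j : ℤ)) := fun j => by
    rw [map_pow, hvϖ, ← WithZero.exp_nsmul, nsmul_eq_mul, mul_neg, mul_one]
  obtain ⟨-, hvϖ1, hvm1, -, -, -⟩ := shift_parameter_facts hvϖ
  have hO : ∀ {z : K}, Valued.v z ≤ 1 → z ∈ 𝒪[K] := fun hz => (v_le_one_iff_mem_integer _).1 hz
  have hunit : ∀ {z : K}, Valued.v z = 1 → ∃ d ∈ 𝒪[K], d * z = 1 := fun {z} hz =>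
    ⟨z⁻¹, hO (by rw [map_inv₀, hz, inv_one]), inv_mul_cancel₀ fun h0 => by rw [h0, map_zero] at hz; exact zero_ne_one hz⟩
  -- the corner relations and the norm-one scalar
  obtain ⟨⟨R1, R2, R3, R4⟩, hσu⟩ := SplitDictionary.rel_of_coe_eq_block σ t.2 ht
  have hvu : Valued.v u = 1 := by
    -- `|u|² = 1` in `ℤᵐ⁰` (norm-one scalar, `σ` isometric)
    have h := congrArg Valued.v hσu
    rw [map_mul, hd.vσ, map_one] at h
    have hu0 : Valued.v u ≠ 0 := fun h0 => by rw [h0, mul_zero] at h; exact zero_ne_one h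
    rw [← WithZero.exp_log hu0, ← WithZero.exp_add, ← WithZero.exp_zero, WithZero.exp_inj] at h
    rw [← WithZero.exp_log hu0, ← WithZero.exp_zero]
    congr 1; omega
  have hu0 : u ≠ 0 := fun h => by rw [h, map_zero] at hvu; exact zero_ne_one hvu
  -- §2: the `2 × 2` Cayley block `Φ`
  set X₂ : Matrix (Fin 2) (Fin 2) K := ϖ⁻¹ • (u⁻¹ • !![A, C * ρ; C, A] - 1) with hX₂
  set Φ : Matrix (Fin 2) (Fin 2) K := ((2 : K) • (1 : Matrix (Fin 2) (Fin 2) K) + (ϖ + 1) • X₂) * ((2 : K) • (1 : Matrix (Fin 2) (Fin 2) K) + (ϖ - 1) • X₂)⁻¹ with hΦ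
  obtain ⟨hX₂int, hm, hp, ⟨S1, S2, S3, S4⟩, hdisc, heval⟩ := cayleyBlock_two hd R1 R2 R3 R4 hσu hvρ hvC hχ hn2 hN1 X₂ hX₂ Φ hΦ
  have hmU : IsUnit (((2 : K) • (1 : Matrix (Fin 2) (Fin 2) K) + (ϖ - 1) • X₂).det) :=
    isUnit_iff_ne_zero.2 fun h0 => by rw [h0, map_zero] at hm; exact zero_ne_one hm
  -- the literal shift `Y ∈ U` (★ block constructor)
  obtain ⟨Y, hY⟩ := exists_coe_eq_block_of_rel σ (J := (StdForm.antidiagonal 3).over K) rfl S1 S2 S3 S4 (e := (1 : K)) (by rw [map_one, mul_one])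
  -- the shifted coordinate `W = ϖ⁻¹(u⁻¹t − 1)` is the pattern of `X₂` and `0`
  set W : Matrix (Fin 3) (Fin 3) K := ϖ⁻¹ • (u⁻¹ • ((t : GL (Fin 3) K) : Matrix (Fin 3) (Fin 3) K) - 1) with hW
  have hWblk : W = !![X₂ 0 0, 0, X₂ 0 1; 0, 0, 0; X₂ 1 0, 0, X₂ 1 1] := by
    rw [hW, ht, hX₂]; ext i j; fin_cases i <;> fin_cases j <;> simp [hu0]
  have hWint : ∀ i j, W i j ∈ 𝒪[K] := by
    intro i j
    refine hO ?_
    rw [hWblk]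
    fin_cases i <;> fin_cases j <;> simp [hX₂int]
  have hϖO : ϖ ∈ 𝒪[K] := hO hvϖ1.le
  -- the cofactors `N± = 2 + (ϖ±1)W` blockwise, their determinants are units
  have hNm : (2 : K) • (1 : Matrix (Fin 3) (Fin 3) K) + (ϖ - 1) • W =
      !![((2 : K) • (1 : Matrix (Fin 2) (Fin 2) K) + (ϖ - 1) • X₂) 0 0, 0, ((2 : K) • (1 : Matrix (Fin 2) (Fin 2) K) + (ϖ - 1) • X₂) 0 1; 0, 2 + (ϖ - 1) * 0, 0;
        ((2 : K) • (1 : Matrix (Fin 2) (Fin 2) K) + (ϖ - 1) • X₂) 1 0, 0, ((2 : K) • (1 : Matrix (Fin 2) (Fin 2) K) + (ϖ - 1) • X₂) 1 1] := by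
    rw [hWblk, smul_one_add_smul_cayleyPattern]
  have hNp : (2 : K) • (1 : Matrix (Fin 3) (Fin 3) K) + (ϖ + 1) • W =
      !![((2 : K) • (1 : Matrix (Fin 2) (Fin 2) K) + (ϖ + 1) • X₂) 0 0, 0, ((2 : K) • (1 : Matrix (Fin 2) (Fin 2) K) + (ϖ + 1) • X₂) 0 1; 0, 2 + (ϖ + 1) * 0, 0;
        ((2 : K) • (1 : Matrix (Fin 2) (Fin 2) K) + (ϖ + 1) • X₂) 1 0, 0, ((2 : K) • (1 : Matrix (Fin 2) (Fin 2) K) + (ϖ + 1) • X₂) 1 1] := by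
    rw [hWblk, smul_one_add_smul_cayleyPattern]
  have hvNm : Valued.v ((2 : K) • (1 : Matrix (Fin 3) (Fin 3) K) + (ϖ - 1) • W).det = 1 := by
    rw [hNm, det_cayleyPattern, mul_zero, add_zero, map_mul, hd.v2, hm, one_mul]
  have hvNp : Valued.v ((2 : K) • (1 : Matrix (Fin 3) (Fin 3) K) + (ϖ + 1) • W).det = 1 := by
    rw [hNp, det_cayleyPattern, mul_zero, add_zero, map_mul, hd.v2, hp, one_mul]
  have hm3 := hunit hvNm
  have hp3 := hunit hvNp
  have hNmU : IsUnit ((2 : K) • (1 : Matrix (Fin 3) (Fin 3) K) + (ϖ - 1) • W).det :=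
    isUnit_iff_ne_zero.2 fun h0 => by rw [h0, map_zero] at hvNm; exact zero_ne_one hvNm
  -- `Y = N₊N₋⁻¹` blockwise
  have hΦNm : Φ * ((2 : K) • (1 : Matrix (Fin 2) (Fin 2) K) + (ϖ - 1) • X₂) = (2 : K) • (1 : Matrix (Fin 2) (Fin 2) K) + (ϖ + 1) • X₂ := by
    rw [hΦ, Matrix.mul_assoc, Matrix.nonsing_inv_mul _ hmU, Matrix.mul_one]
  have hkey : ((Y : GL (Fin 3) K) : Matrix (Fin 3) (Fin 3) K) * ((2 : K) • (1 : Matrix (Fin 3) (Fin 3) K) + (ϖ - 1) • W) =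
      (2 : K) • (1 : Matrix (Fin 3) (Fin 3) K) + (ϖ + 1) • W := by
    rw [hY, hNm, cayleyPattern_mul, hΦNm, hNp]
    ext i j; fin_cases i <;> fin_cases j <;> simp
  have hE : ((2 : K) • (1 : Matrix (Fin 3) (Fin 3) K) + (ϖ + 1) • W) * ((2 : K) • (1 : Matrix (Fin 3) (Fin 3) K) + (ϖ - 1) • W)⁻¹ =
      ((Y : GL (Fin 3) K) : Matrix (Fin 3) (Fin 3) K) := by
    rw [← hkey, Matrix.mul_assoc, Matrix.mul_nonsing_inv _ hNmU, Matrix.mul_one]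
  -- ★ the three memberships of the shifted order, at `W`
  have h4 := moebius_mem_adjoin 𝒪[K] hWint hϖO hm3
  have h5 := moebius_inv_mem_adjoin 𝒪[K] hWint hϖO hm3 hp3
  have h6 := mem_adjoin_moebius 𝒪[K] hWint hϖO (hunit hd.v2) (hunit hvm1) hm3
  rw [hE] at h4 h5 h6
  -- the eigenvector: `x` is a multiple of `e₁`
  have h0 := congrFun htx 0
  have h2 := congrFun htx 2
  simp [ht, Matrix.mulVec, dotProduct, Fin.sum_univ_three] at h0 h2
  have hχ0 : (u - A) ^ 2 - C ^ 2 * ρ ≠ 0 := fun h0' => by rw [h0', map_zero, hvpow] at hχ; exact WithZero.zero_ne_coe hχ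
  have hx0 : x 0 = 0 := by
    have e : ((u - A) ^ 2 - C ^ 2 * ρ) * x 0 = 0 := by linear_combination (A - u) * h0 - C * ρ * h2
    exact (mul_eq_zero.1 e).resolve_left hχ0
  have hx2 : x 2 = 0 := by
    have e : ((u - A) ^ 2 - C ^ 2 * ρ) * x 2 = 0 := by linear_combination (-C) * h0 + (A - u) * h2
    exact (mul_eq_zero.1 e).resolve_left hχ0
  refine ⟨Y, ?_, ?_, ?_, ?_, ?_, ?_⟩
  · rw [hY, one_smul]
    ext i; fin_cases i <;> simp [Matrix.mulVec, dotProduct, Fin.sum_univ_three, hx0, hx2]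
  · rw [hY, trace_cayleyPattern, det_cayleyPattern, show (Φ.trace + 1 - 1) ^ 2 - 4 * (1 * Φ.det / 1) = Φ.trace ^ 2 - 4 * Φ.det by ring]
    exact hdisc
  · rw [hY, trace_cayleyPattern, det_cayleyPattern]
    rw [Matrix.charpoly_fin_two] at heval
    simp only [eval_add, eval_sub, eval_mul, eval_pow, eval_C, eval_X] at heval
    rw [show (1 : K) ^ 2 - (Φ.trace + 1 - 1) * 1 + 1 * Φ.det / 1 = 1 ^ 2 - Φ.trace * 1 + Φ.det by ring]
    exact heval
  · rw [adjoin_one_add_eq]; exact h4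
  · rw [Matrix.coe_units_inv, adjoin_one_add_eq]; exact h5
  · exact Subalgebra.add_mem _ (Subalgebra.one_mem _) h6

end Literal

end Summit.HodgeConjecture.HodgeConjecture.R90.S6

end
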